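import Summits.QuantumFields.BalabanUV.T4Continuum.Support.SubstrateGaussianLetters

/-!
# T⁴ programme, SUBSTRATE (shared lattice-gauge analysis library) — THE GAUSSIAN LETTERS ON THE OPERATOR BALL: the determinant of the
# affine reading is LIPSCHITZ in the datum, so on a small ball around a centre with real positive determinant it stays in the slit plane and
# bounded — the two displayed smallness conditions of `SubstrateGaussianLetters.differentiableOn_gaussN` ∕ `norm_gaussN_le` DISCHARGED from two
# explicit inequalities on the operator radius `R′` (item S-U3 letters, follower; MAP v0.3 §4 p3 (3))

Substrate cell `b2b-balaban-substrate-*`, seat p3.  File 1 (`SubstrateGaussianLetters`) proved the `hq` binders of NE5's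
`B13TermParamGaussianBi.termGaussianParamBi_termBi` for `q := gaussQ (linForm base rd) coords` outright, and the `hN` binders for
`N := gaussN (linForm base rd)` modulo «`det A(o,p) ∈ slitPlane` on the ball» and «`‖det A(o,p)‖ ≤ D`».  THIS FILE removes the modulo:
 * §1 determinant bookkeeping ([folklore]): `norm_prod_le_pow`, **`norm_prod_sub_prod_le`** (`‖Πa − Πb‖ ≤ n·β^{n−1}·δ`), **`norm_det_le_of_entry_le`**
   (`‖det A‖ ≤ n!·βⁿ`), **`norm_det_sub_det_le`** (`‖det A − det B‖ ≤ n!·n·β^{n−1}·δ` for entries `≤ β` differing by `≤ δ`), `n = card m`;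
 * §2 on the ball `‖o − c‖ < R′` of the affine reading (`‖rd p i j‖ ≤ ϑ`, centre entries `≤ β₀`): entries move by `≤ ϑR′` (`linForm_entry_sub_le`),
   stay `≤ β₀ + ϑR′`, and **`norm_det_linForm_sub_le`**: `‖det A(o,p) − det A(c,p)‖ ≤ detBudget (card m) β₀ ϑ R′ := n!·n·(β₀ + ϑR′)^{n−1}·ϑR′`;
 * §3 the binders: if the centre determinant is REAL with `d₀ ≤ Re det A(c,p)` (`d₀ > 0`; e.g. a real positive-definite centre) and
   `detBudget (card m) β₀ ϑ R′ < d₀`, then on the ball `det A(o,p) ∈ slitPlane` (**`det_linForm_mem_slitPlane`**), `‖det A(o,p)‖ ≤ n!·β₀ⁿ + d₀`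
   (**`norm_det_linForm_le`**), hence **`differentiableOn_gaussN_linForm`** (`o ↦ N(o,p)` holomorphic on `ball c R′`) and
   **`norm_gaussN_linForm_le`** (`‖N(o,p)‖ ≤ (2π)^{−n/2}·√(max 1 (n!·β₀ⁿ + d₀))`) — the literal `hN` clauses, per parameter `p`.

BRANCH REMARK (XREAD ne5-leaf-02-g10 INFO I11).  `gaussN` is the PRINCIPAL root `(2π)^{−n/2}·exp(Log det ∕ 2)`; the Gaussian normalisation of an
accretive complex-symmetric form is the analytically continued `Π_j λ_j^{1/2}`, which may differ from the principal root by a sign in general — but on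
the regime of this file (a connected operator ball containing a centre with REAL POSITIVE determinant, `det` in the slit plane throughout) the two
continuous roots agree, so the letters are the intended ones where they are used.

HONEST FRAMING (T4-DAG p. 1).  Finite-dimensional bookkeeping ([folklore]); no estimate of any NE row; nothing printed is a hypothesis or a
conclusion; no `def … : Prop`; spine 0/9 unchanged; NOT infinite volume ∕ mass gap ∕ Clay.  HONEST DEPENDENCY: continuum YM on T⁴ ⇐ BetaPertH ∧
nine spine estimates (0/9 proved); BetaPertH ⇐ (D1) ∧ (D4) ∧ CAP+tail; G-an2-4 gates asym, D1 and NE2/3/4.  ABSOLUTE RULE kept; no `sorry`.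
-/

noncomputable section

open scoped BigOperators ComplexConjugate Matrix
open Metric

namespace Summit.QuantumFields.BalabanUV.T4Continuum.SubstrateGaussianLettersBall

open Summit.QuantumFields.BalabanUV.T4Continuum.SubstrateGaussianLetters

variable {m : Type*} [Fintype m] [DecidableEq m]

/-! ## §1 Determinant bookkeeping -/

/-- `‖Π_{i∈s} a_i‖ ≤ β^{#s}` when every `‖a_i‖ ≤ β`. [folklore] -/
theorem norm_prod_le_pow {ι : Type*} (s : Finset ι) {a : ι → ℂ} {β : ℝ} (ha : ∀ i ∈ s, ‖a i‖ ≤ β) : ‖∏ i ∈ s, a i‖ ≤ β ^ s.card := by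
  calc ‖∏ i ∈ s, a i‖ ≤ ∏ i ∈ s, ‖a i‖ := Finset.norm_prod_le _ _
    _ ≤ ∏ _i ∈ s, β := Finset.prod_le_prod (fun i _ => norm_nonneg _) ha
    _ = β ^ s.card := Finset.prod_const β

/-- the arithmetic of the telescoping step: `(n+1)·βⁿ = β·(n·β^{n−1}) + βⁿ` (also at `n = 0`, where `n·β^{n−1} = 0`). [folklore] -/
theorem succ_mul_pow_eq (β : ℝ) (n : ℕ) : ((n + 1 : ℕ) : ℝ) * β ^ n = β * (n * β ^ (n - 1)) + β ^ n := by
  cases n with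
  | zero => simp
  | succ k => rw [Nat.add_sub_cancel, pow_succ]; push_cast; ring

/-- **`‖Πa − Πb‖ ≤ #s·β^{#s−1}·δ`** for `‖a_i‖, ‖b_i‖ ≤ β` and `‖a_i − b_i‖ ≤ δ` (telescoping). [folklore] -/
theorem norm_prod_sub_prod_le {ι : Type*} [DecidableEq ι] (s : Finset ι) {a b : ι → ℂ} {β δ : ℝ} (hβ : 0 ≤ β)
    (ha : ∀ i ∈ s, ‖a i‖ ≤ β) (hb : ∀ i ∈ s, ‖b i‖ ≤ β) (hab : ∀ i ∈ s, ‖a i - b i‖ ≤ δ) :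
    ‖∏ i ∈ s, a i - ∏ i ∈ s, b i‖ ≤ s.card * β ^ (s.card - 1) * δ := by
  induction s using Finset.induction_on with
  | empty => simp
  | insert k s hk ih =>
    have hδ : 0 ≤ δ := (norm_nonneg _).trans (hab k (Finset.mem_insert_self k s))
    have ha' : ∀ i ∈ s, ‖a i‖ ≤ β := fun i hi => ha i (Finset.mem_insert_of_mem hi)
    have hb' : ∀ i ∈ s, ‖b i‖ ≤ β := fun i hi => hb i (Finset.mem_insert_of_mem hi)
    have ih' := ih ha' hb' fun i hi => hab i (Finset.mem_insert_of_mem hi)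
    rw [Finset.prod_insert hk, Finset.prod_insert hk, Finset.card_insert_of_notMem hk,
      show a k * ∏ i ∈ s, a i - b k * ∏ i ∈ s, b i = a k * (∏ i ∈ s, a i - ∏ i ∈ s, b i) + (a k - b k) * ∏ i ∈ s, b i by ring]
    calc _ ≤ ‖a k * (∏ i ∈ s, a i - ∏ i ∈ s, b i)‖ + ‖(a k - b k) * ∏ i ∈ s, b i‖ := norm_add_le _ _
      _ ≤ β * (s.card * β ^ (s.card - 1) * δ) + δ * β ^ s.card := by
          rw [norm_mul, norm_mul]
          exact add_le_add (mul_le_mul (ha k (Finset.mem_insert_self k s)) ih' (norm_nonneg _) hβ)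
            (mul_le_mul (hab k (Finset.mem_insert_self k s)) (norm_prod_le_pow s hb') (norm_nonneg _) hδ)
      _ = ((s.card + 1 : ℕ) : ℝ) * β ^ s.card * δ := by rw [succ_mul_pow_eq]; ring
      _ = _ := by rw [Nat.add_sub_cancel]

/-- the sign of a permutation has norm one in `ℂ`. [folklore] -/
theorem norm_sign_cast (σ : Equiv.Perm m) : ‖((Equiv.Perm.sign σ : ℤ) : ℂ)‖ = 1 := by
  rcases Int.units_eq_one_or (Equiv.Perm.sign σ) with h | h <;> simp [h]

/-- **`‖det A‖ ≤ n!·βⁿ`** for entries `‖A_{ij}‖ ≤ β` (`n = card m`). [folklore] -/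
theorem norm_det_le_of_entry_le {A : Matrix m m ℂ} {β : ℝ} (hA : ∀ i j, ‖A i j‖ ≤ β) :
    ‖A.det‖ ≤ (Fintype.card m).factorial * β ^ Fintype.card m := by
  rw [Matrix.det_apply]
  calc ‖∑ σ : Equiv.Perm m, Equiv.Perm.sign σ • ∏ i, A (σ i) i‖ ≤ ∑ σ : Equiv.Perm m, ‖Equiv.Perm.sign σ • ∏ i, A (σ i) i‖ := norm_sum_le _ _
    _ ≤ ∑ _σ : Equiv.Perm m, β ^ Fintype.card m := Finset.sum_le_sum fun σ _ => by
        rw [Units.smul_def, zsmul_eq_mul, norm_mul, norm_sign_cast, one_mul]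
        exact norm_prod_le_pow _ fun i _ => hA (σ i) i
    _ = (Fintype.card m).factorial * β ^ Fintype.card m := by rw [Finset.sum_const, Finset.card_univ, Fintype.card_perm, nsmul_eq_mul]

/-- **`‖det A − det B‖ ≤ n!·(n·β^{n−1}·δ)`** for entries `≤ β` (`β ≥ 0`) differing by `≤ δ` (`n = card m`). [folklore] -/
theorem norm_det_sub_det_le {A B : Matrix m m ℂ} {β δ : ℝ} (hβ : 0 ≤ β) (hA : ∀ i j, ‖A i j‖ ≤ β) (hB : ∀ i j, ‖B i j‖ ≤ β)
    (hAB : ∀ i j, ‖A i j - B i j‖ ≤ δ) :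
    ‖A.det - B.det‖ ≤ (Fintype.card m).factorial * (Fintype.card m * β ^ (Fintype.card m - 1) * δ) := by
  rw [Matrix.det_apply, Matrix.det_apply, ← Finset.sum_sub_distrib]
  calc ‖∑ σ : Equiv.Perm m, (Equiv.Perm.sign σ • ∏ i, A (σ i) i - Equiv.Perm.sign σ • ∏ i, B (σ i) i)‖
      ≤ ∑ σ : Equiv.Perm m, ‖Equiv.Perm.sign σ • ∏ i, A (σ i) i - Equiv.Perm.sign σ • ∏ i, B (σ i) i‖ := norm_sum_le _ _
    _ ≤ ∑ _σ : Equiv.Perm m, Fintype.card m * β ^ (Fintype.card m - 1) * δ := Finset.sum_le_sum fun σ _ => by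
        rw [Units.smul_def, Units.smul_def, zsmul_eq_mul, zsmul_eq_mul, ← mul_sub, norm_mul, norm_sign_cast, one_mul]
        exact norm_prod_sub_prod_le _ hβ (fun i _ => hA (σ i) i) (fun i _ => hB (σ i) i) fun i _ => hAB (σ i) i
    _ = _ := by rw [Finset.sum_const, Finset.card_univ, Fintype.card_perm, nsmul_eq_mul]

/-! ## §2 The affine reading on the operator ball -/

section Ball

variable {Op PΛ : Type*} [NormedAddCommGroup Op] [NormedSpace ℂ Op]
variable (base : PΛ → Matrix m m ℂ) (rd : PΛ → m → m → (Op →L[ℂ] ℂ))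

omit [Fintype m] [DecidableEq m] in
/-- entries move by at most `ϑ·R′` on the ball. [folklore] -/
theorem linForm_entry_sub_le {c o : Op} {p : PΛ} {ϑ R' : ℝ} (hrd : ∀ i j, ‖rd p i j‖ ≤ ϑ) (ho : ‖o - c‖ ≤ R') (i j : m) :
    ‖linForm base rd o p i j - linForm base rd c p i j‖ ≤ ϑ * R' := by
  rw [linForm_apply, linForm_apply, show base p i j + rd p i j o - (base p i j + rd p i j c) = rd p i j (o - c) by rw [map_sub]; ring]
  exact ((rd p i j).le_opNorm _).trans (mul_le_mul (hrd i j) ho (norm_nonneg _) ((norm_nonneg _).trans (hrd i j)))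

omit [Fintype m] [DecidableEq m] in
/-- entries stay `≤ β₀ + ϑR′` on the ball if they are `≤ β₀` at the centre. [folklore] -/
theorem linForm_entry_le {c o : Op} {p : PΛ} {β₀ ϑ R' : ℝ} (hc : ∀ i j, ‖linForm base rd c p i j‖ ≤ β₀) (hrd : ∀ i j, ‖rd p i j‖ ≤ ϑ)
    (ho : ‖o - c‖ ≤ R') (i j : m) : ‖linForm base rd o p i j‖ ≤ β₀ + ϑ * R' := by
  have h := linForm_entry_sub_le base rd hrd ho i j
  calc ‖linForm base rd o p i j‖ = ‖linForm base rd c p i j + (linForm base rd o p i j - linForm base rd c p i j)‖ := by rw [add_sub_cancel]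
    _ ≤ β₀ + ϑ * R' := (norm_add_le _ _).trans (add_le_add (hc i j) h)

/-- the DETERMINANT BUDGET of the ball: `n!·(n·(β₀ + ϑR′)^{n−1}·ϑR′)`. [folklore] -/
def detBudget (n : ℕ) (β₀ ϑ R' : ℝ) : ℝ := n.factorial * (n * (β₀ + ϑ * R') ^ (n - 1) * (ϑ * R'))

/-- **`‖det A(o,p) − det A(c,p)‖ ≤ detBudget`** on the ball. [folklore] -/
theorem norm_det_linForm_sub_le {c o : Op} {p : PΛ} {β₀ ϑ R' : ℝ} (hβ₀ : 0 ≤ β₀) (hR' : 0 ≤ R') (hc : ∀ i j, ‖linForm base rd c p i j‖ ≤ β₀)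
    (hrd : ∀ i j, ‖rd p i j‖ ≤ ϑ) (ho : ‖o - c‖ ≤ R') :
    ‖(linForm base rd o p).det - (linForm base rd c p).det‖ ≤ detBudget (Fintype.card m) β₀ ϑ R' := by
  rcases isEmpty_or_nonempty m with hm | hm
  · -- no coordinates: both determinants are `1`
    simp [Matrix.det_isEmpty, detBudget]
  have hϑ : 0 ≤ ϑ := (norm_nonneg _).trans (hrd (Classical.arbitrary m) (Classical.arbitrary m))
  have hϑR : 0 ≤ ϑ * R' := mul_nonneg hϑ hR'
  exact norm_det_sub_det_le (by positivity) (linForm_entry_le base rd hc hrd ho) (fun i j => (hc i j).trans (le_add_of_nonneg_right hϑR))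
    (linForm_entry_sub_le base rd hrd ho)

/-! ## §3 The `hN` binders on the ball -/

/-- **SLIT PLANE ON THE BALL**: a REAL centre determinant with `d₀ ≤ Re det A(c,p)`, `0 < d₀`, and `detBudget < d₀` keep `det A(o,p)` in the slit
plane for every `o ∈ ball c R′`. [folklore] -/
theorem det_linForm_mem_slitPlane {c : Op} {p : PΛ} {β₀ ϑ R' d₀ : ℝ} (hβ₀ : 0 ≤ β₀) (hR' : 0 ≤ R') (hc : ∀ i j, ‖linForm base rd c p i j‖ ≤ β₀)
    (hrd : ∀ i j, ‖rd p i j‖ ≤ ϑ) (hreal : ((linForm base rd c p).det).im = 0) (hd₀ : 0 < d₀) (hpos : d₀ ≤ ((linForm base rd c p).det).re)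
    (hsmall : detBudget (Fintype.card m) β₀ ϑ R' < d₀) {o : Op} (ho : o ∈ ball c R') : (linForm base rd o p).det ∈ Complex.slitPlane := by
  set dc := (linForm base rd c p).det with hdc
  have hdc' : dc = ((dc.re : ℝ) : ℂ) := Complex.ext (by simp) (by simp [hreal])
  have hbud := norm_det_linForm_sub_le base rd hβ₀ hR' hc hrd (le_of_lt (mem_ball_iff_norm.mp ho))
  rw [← hdc] at hbud
  refine mem_slitPlane_of_norm_sub_lt (lt_of_lt_of_le hd₀ hpos) ?_
  rw [← hdc']
  linarith

/-- **DETERMINANT BOUND ON THE BALL**: `‖det A(o,p)‖ ≤ n!·β₀ⁿ + d₀` under the same smallness. [folklore] -/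
theorem norm_det_linForm_le {c : Op} {p : PΛ} {β₀ ϑ R' d₀ : ℝ} (hβ₀ : 0 ≤ β₀) (hR' : 0 ≤ R') (hc : ∀ i j, ‖linForm base rd c p i j‖ ≤ β₀)
    (hrd : ∀ i j, ‖rd p i j‖ ≤ ϑ) (hsmall : detBudget (Fintype.card m) β₀ ϑ R' < d₀) {o : Op} (ho : o ∈ ball c R') :
    ‖(linForm base rd o p).det‖ ≤ (Fintype.card m).factorial * β₀ ^ Fintype.card m + d₀ := by
  have hbud := norm_det_linForm_sub_le base rd hβ₀ hR' hc hrd (le_of_lt (mem_ball_iff_norm.mp ho))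
  have hcen := norm_det_le_of_entry_le hc
  calc ‖(linForm base rd o p).det‖ = ‖(linForm base rd c p).det + ((linForm base rd o p).det - (linForm base rd c p).det)‖ := by rw [add_sub_cancel]
    _ ≤ ‖(linForm base rd c p).det‖ + ‖(linForm base rd o p).det - (linForm base rd c p).det‖ := norm_add_le _ _
    _ ≤ _ := by linarith

/-- **THE HOLOMORPHY BINDER for `N` ON THE BALL** (literal `hN` clause, per parameter `p`): `o ↦ N(o,p)` is holomorphic on `ball c R′`. [folklore] -/
theorem differentiableOn_gaussN_linForm {c : Op} {p : PΛ} {β₀ ϑ R' d₀ : ℝ} (hβ₀ : 0 ≤ β₀) (hR' : 0 ≤ R')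
    (hc : ∀ i j, ‖linForm base rd c p i j‖ ≤ β₀) (hrd : ∀ i j, ‖rd p i j‖ ≤ ϑ) (hreal : ((linForm base rd c p).det).im = 0) (hd₀ : 0 < d₀)
    (hpos : d₀ ≤ ((linForm base rd c p).det).re) (hsmall : detBudget (Fintype.card m) β₀ ϑ R' < d₀) :
    DifferentiableOn ℂ (fun o => gaussN (linForm base rd) o p) (ball c R') :=
  differentiableOn_gaussN (linForm base rd) (fun i j => differentiableOn_linForm base rd _ p i j)
    fun _ ho => det_linForm_mem_slitPlane base rd hβ₀ hR' hc hrd hreal hd₀ hpos hsmall ho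

/-- **THE BOUND BINDER for `N` ON THE BALL** (literal `hN` clause): `‖N(o,p)‖ ≤ (2π)^{−n/2}·√(max 1 (n!·β₀ⁿ + d₀))`. [folklore] -/
theorem norm_gaussN_linForm_le {c : Op} {p : PΛ} {β₀ ϑ R' d₀ : ℝ} (hβ₀ : 0 ≤ β₀) (hR' : 0 ≤ R')
    (hc : ∀ i j, ‖linForm base rd c p i j‖ ≤ β₀) (hrd : ∀ i j, ‖rd p i j‖ ≤ ϑ) (hsmall : detBudget (Fintype.card m) β₀ ϑ R' < d₀)
    {o : Op} (ho : o ∈ ball c R') :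
    ‖gaussN (linForm base rd) o p‖ ≤ gaussC m * Real.sqrt (max 1 ((Fintype.card m).factorial * β₀ ^ Fintype.card m + d₀)) :=
  norm_gaussN_le (linForm base rd) ((norm_det_linForm_le base rd hβ₀ hR' hc hrd hsmall ho).trans (le_max_right _ _)) (le_max_left _ _)

end Ball

end Summit.QuantumFields.BalabanUV.T4Continuum.SubstrateGaussianLettersBall

end
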